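import Mathlib
import HarnessLib
import Summits.NavierStokesRegularity.NavierStokesRegularity.Theses.RigidMotionDoor
import Summits.NavierStokesRegularity.NavierStokesRegularity.Theorems.LocalSineTubeDoorLocalPointZoomGradSlices
import Summits.NavierStokesRegularity.NavierStokesRegularity.Theorems.LocalSineTubeDoorProfileAlignedWindowRigidityAncient
import Summits.NavierStokesRegularity.NavierStokesRegularity.Theorems.UnthreadedDoorUnthreadedZoom
import Literature.Analysis.FluidPDE.TypeIAncientMild
import Literature.Analysis.FluidPDE.MildSolution

/-!
# Route `RigidMotionDoor` — THE RIGID ZOOM (item stmt-NavierStokesRegularity-27903, `RigidMotionDoor.RigidZoom`), PROVED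

**Statement (verbatim route decl).** Under the frame hypotheses of the door's `Target` (classical NS on `[0,T)`, Leray–Hopf, rapidly decaying
datum, locally Type I at `(x₀, T)`), a time-dependent normalised PITCHLESS Killing field `y ↦ A t y + b t` (`A t` skew; `A t = 0` or
`A t y + b t = A t (y − c)`; `‖A t‖ + ‖b t‖ = 1`) whose scale-invariant symmetry defect
`(T−t) ∇u(t)(x₀ + √(T−t) y)(A t y + b t) − √(T−t) A t (u(t)(x₀ + √(T−t) y))` fades in mean square on every similarity ball as `t → T⁻`,
and failure of backward boundedness at `(x₀,T)` yield a profile `v` of the Type-I ancient Oseen-mild class, backward singular at the apex,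
each of whose slices `v(s)`, `s < 0`, has an exact non-zero pitchless Euclidean infinitesimal symmetry `(B, e)`.

* `RigidZoom.axial`, `apply_coord`, `norm_axial_sq`, `eq_zero_of_axial_eq_zero`, `apply_apply_apply` (`A³ = −‖ω(A)‖² A` for skew `A` on `ℝ³`),
  `defect_eq_zero_of_pitchless` / `pitchless_of_defect_eq_zero` (PITCHLESS ⟺ `A (A b) + ‖ω(A)‖² b = 0`, foot `c = ‖ω‖⁻² A b`),
  `tendsto_defect` — the pitchless Killing fields form a CLOSED cone;
* `ZoomFading.tendsto_clm_apply`, `fading_inner_of_fading_norm_sq`, `eq_zero_of_fading_norm_sq` — the VECTOR form of the tree's fading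
  lemma `ZoomFading.eq_zero_of_fading_sq` (Fatou + continuity, `…UnthreadedDoorUnthreadedZoom`);
* `rigidMotionDoor_rigidZoom_proof` — the item BY NAME.

HONEST FRAMING: a compactness/bookkeeping lemma about a HYPOTHETICAL locally Type-I blow-up (item of a DRAFT door route); nothing here bears
on `EuclidAccumulation` (stmt-27902), on the door's `Target`, or on Navier–Stokes regularity.
-/

noncomputable section

set_option linter.dupNamespace false

namespace Summit.NavierStokesRegularity.NavierStokesRegularity.Theorems

open MeasureTheory Set Filter Topology Metric Function
open Literature.Analysis Literature.Analysis.FluidPDE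
open scoped RealInnerProductSpace InnerProductSpace ENNReal


namespace RigidZoom

/-- Polarisation: `⟪A x, x⟫ = 0` for all `x` gives `⟪A x, y⟫ = -⟪A y, x⟫`. [folklore] -/
theorem inner_map_swap_of_skew {A : (EuclideanSpace ℝ (Fin 3)) →L[ℝ] (EuclideanSpace ℝ (Fin 3))} (hskew : ∀ x, ⟪A x, x⟫_ℝ = 0) (x y : (EuclideanSpace ℝ (Fin 3))) :
    ⟪A x, y⟫_ℝ = -⟪A y, x⟫_ℝ := by
  have h := hskew (x + y)
  rw [map_add, inner_add_left, inner_add_right, inner_add_right, hskew x, hskew y] at h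
  linarith

/-- Matrix entries of a skew map are antisymmetric: `(A e_j)_i = -(A e_i)_j`. [folklore] -/
theorem apply_single_skew {A : (EuclideanSpace ℝ (Fin 3)) →L[ℝ] (EuclideanSpace ℝ (Fin 3))} (hskew : ∀ x, ⟪A x, x⟫_ℝ = 0) (i j : Fin 3) :
    A (EuclideanSpace.single j 1) i = -A (EuclideanSpace.single i 1) j := by
  have h := inner_map_swap_of_skew hskew (EuclideanSpace.single j 1) (EuclideanSpace.single i 1)
  simpa [EuclideanSpace.inner_single_right] using h

/-- Expansion along the standard basis: `A x = x₀ A e₀ + x₁ A e₁ + x₂ A e₂`. [folklore] -/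
theorem clm_apply_eq_sum_three (A : (EuclideanSpace ℝ (Fin 3)) →L[ℝ] (EuclideanSpace ℝ (Fin 3))) (x : (EuclideanSpace ℝ (Fin 3))) :
    A x = x 0 • A (EuclideanSpace.single 0 1) + x 1 • A (EuclideanSpace.single 1 1) +
      x 2 • A (EuclideanSpace.single 2 1) := by
  have hx : x = x 0 • EuclideanSpace.single (0 : Fin 3) (1 : ℝ) +
      x 1 • EuclideanSpace.single (1 : Fin 3) (1 : ℝ) +
      x 2 • EuclideanSpace.single (2 : Fin 3) (1 : ℝ) := by
    ext i; fin_cases i <;> simp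
  conv_lhs => rw [hx]
  simp only [map_add, map_smul]

/-- **The axial vector** of a (skew) map of `ℝ³`: `ω(A) = (a₂₁, a₀₂, a₁₀)` with `a_{ij} = (A e_j)_i`, so that
`A x = ω(A) × x` for skew `A`; written basis-free enough to be manifestly continuous in `A`. [folklore] -/
def axial (A : (EuclideanSpace ℝ (Fin 3)) →L[ℝ] (EuclideanSpace ℝ (Fin 3))) : (EuclideanSpace ℝ (Fin 3)) :=
  (A (EuclideanSpace.single 1 1) 2) • EuclideanSpace.single 0 (1 : ℝ) +
    (-(A (EuclideanSpace.single 0 1) 2)) • EuclideanSpace.single 1 (1 : ℝ) +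
    (A (EuclideanSpace.single 0 1) 1) • EuclideanSpace.single 2 (1 : ℝ)

/-- The `0`-th coordinate of the axial vector. [folklore] -/
theorem axial_apply_zero (A : (EuclideanSpace ℝ (Fin 3)) →L[ℝ] (EuclideanSpace ℝ (Fin 3))) : axial A 0 = A (EuclideanSpace.single 1 1) 2 := by
  simp [axial]

/-- The `1`-st coordinate of the axial vector. [folklore] -/
theorem axial_apply_one (A : (EuclideanSpace ℝ (Fin 3)) →L[ℝ] (EuclideanSpace ℝ (Fin 3))) : axial A 1 = -(A (EuclideanSpace.single 0 1) 2) := by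
  simp [axial]

/-- The `2`-nd coordinate of the axial vector. [folklore] -/
theorem axial_apply_two (A : (EuclideanSpace ℝ (Fin 3)) →L[ℝ] (EuclideanSpace ℝ (Fin 3))) : axial A 2 = A (EuclideanSpace.single 0 1) 1 := by
  simp [axial]

/-- The coordinates of a skew map of `ℝ³` in terms of its three lower entries `a = a₁₀`, `b = a₂₀`, `d = a₂₁`:
`(A x)₀ = -a x₁ - b x₂`, `(A x)₁ = a x₀ - d x₂`, `(A x)₂ = b x₀ + d x₁`. [folklore] -/
theorem apply_coord {A : (EuclideanSpace ℝ (Fin 3)) →L[ℝ] (EuclideanSpace ℝ (Fin 3))} (hskew : ∀ x, ⟪A x, x⟫_ℝ = 0) (x : (EuclideanSpace ℝ (Fin 3))) :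
    A x 0 = -(A (EuclideanSpace.single 0 1) 1) * x 1 - (A (EuclideanSpace.single 0 1) 2) * x 2 ∧
    A x 1 = (A (EuclideanSpace.single 0 1) 1) * x 0 - (A (EuclideanSpace.single 1 1) 2) * x 2 ∧
    A x 2 = (A (EuclideanSpace.single 0 1) 2) * x 0 + (A (EuclideanSpace.single 1 1) 2) * x 1 := by
  have h00 : A (EuclideanSpace.single 0 1) 0 = 0 := by linarith [apply_single_skew hskew 0 0]
  have h11 : A (EuclideanSpace.single 1 1) 1 = 0 := by linarith [apply_single_skew hskew 1 1]
  have h22 : A (EuclideanSpace.single 2 1) 2 = 0 := by linarith [apply_single_skew hskew 2 2]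
  have h01 := apply_single_skew hskew 0 1
  have h02 := apply_single_skew hskew 0 2
  have h12 := apply_single_skew hskew 1 2
  refine ⟨?_, ?_, ?_⟩ <;>
  · rw [clm_apply_eq_sum_three A x]
    simp [h00, h11, h22, h01, h02, h12]
    ring

/-- `‖ω(A)‖² = a² + b² + d²`. [folklore] -/
theorem norm_axial_sq (A : (EuclideanSpace ℝ (Fin 3)) →L[ℝ] (EuclideanSpace ℝ (Fin 3))) :
    ‖axial A‖ ^ 2 = (A (EuclideanSpace.single 0 1) 1) ^ 2 + (A (EuclideanSpace.single 0 1) 2) ^ 2 +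
      (A (EuclideanSpace.single 1 1) 2) ^ 2 := by
  rw [EuclideanSpace.norm_eq, Real.sq_sqrt (Finset.sum_nonneg fun i _ => sq_nonneg _), Fin.sum_univ_three,
    axial_apply_zero, axial_apply_one, axial_apply_two]
  simp only [Real.norm_eq_abs, sq_abs]
  ring

/-- A skew map with zero axial vector is zero. [folklore] -/
theorem eq_zero_of_axial_eq_zero {A : (EuclideanSpace ℝ (Fin 3)) →L[ℝ] (EuclideanSpace ℝ (Fin 3))} (hskew : ∀ x, ⟪A x, x⟫_ℝ = 0) (h : axial A = 0) : A = 0 := by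
  have ha : A (EuclideanSpace.single 0 1) 1 = 0 := by simpa [axial_apply_two] using congrArg (fun v : (EuclideanSpace ℝ (Fin 3)) => v 2) h
  have hb : A (EuclideanSpace.single 0 1) 2 = 0 := by simpa [axial_apply_one] using congrArg (fun v : (EuclideanSpace ℝ (Fin 3)) => v 1) h
  have hd : A (EuclideanSpace.single 1 1) 2 = 0 := by simpa [axial_apply_zero] using congrArg (fun v : (EuclideanSpace ℝ (Fin 3)) => v 0) h
  ext x i
  obtain ⟨h0, h1, h2⟩ := apply_coord hskew x
  fin_cases i
  · simp only [Fin.zero_eta, h0, ha, hb, zero_apply, PiLp.zero_apply]; ring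
  · simp only [Fin.mk_one, h1, ha, hd, zero_apply, PiLp.zero_apply]; ring
  · simp only [Fin.reduceFinMk, h2, hb, hd, zero_apply, PiLp.zero_apply]; ring

/-- The minimal polynomial of a skew map of `ℝ³`: `A³ = -‖ω(A)‖² A`. [folklore] -/
theorem apply_apply_apply {A : (EuclideanSpace ℝ (Fin 3)) →L[ℝ] (EuclideanSpace ℝ (Fin 3))} (hskew : ∀ x, ⟪A x, x⟫_ℝ = 0) (c : (EuclideanSpace ℝ (Fin 3))) :
    A (A (A c)) = -(‖axial A‖ ^ 2) • A c := by
  rw [norm_axial_sq]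
  obtain ⟨c0, c1, c2⟩ := apply_coord hskew c
  obtain ⟨d0, d1, d2⟩ := apply_coord hskew (A c)
  obtain ⟨e0, e1, e2⟩ := apply_coord hskew (A (A c))
  ext i
  fin_cases i
  · simp only [Fin.zero_eta, e0, d1, d2, c0, c1, c2, PiLp.smul_apply, smul_eq_mul]; ring
  · simp only [Fin.mk_one, e1, d0, d2, c0, c1, c2, PiLp.smul_apply, smul_eq_mul]; ring
  · simp only [Fin.reduceFinMk, e2, d0, d1, c0, c1, c2, PiLp.smul_apply, smul_eq_mul]; ring

/-- **Pitchless Killing fields, closed form.** For a skew `A`, the Killing field `y ↦ A y + b` is PITCHLESS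
(`A = 0`, or the rotation generator about an affine axis: `A y + b = A (y - c)`) iff `A (A b) + ‖ω(A)‖² b = 0`
(i.e. `b ⊥ ω(A)` when `A ≠ 0`). Forward direction. [folklore] -/
theorem defect_eq_zero_of_pitchless {A : (EuclideanSpace ℝ (Fin 3)) →L[ℝ] (EuclideanSpace ℝ (Fin 3))} {b : (EuclideanSpace ℝ (Fin 3))} (hskew : ∀ x, ⟪A x, x⟫_ℝ = 0)
    (h : A = 0 ∨ ∃ c : (EuclideanSpace ℝ (Fin 3)), ∀ y, A y + b = A (y - c)) : A (A b) + ‖axial A‖ ^ 2 • b = 0 := by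
  rcases h with hA | ⟨c, hc⟩
  · subst hA
    have : axial (0 : (EuclideanSpace ℝ (Fin 3)) →L[ℝ] (EuclideanSpace ℝ (Fin 3))) = 0 := by simp [axial]
    simp [this]
  · have hb : b = -A c := by
      have := hc c
      rw [sub_self, map_zero] at this
      exact eq_neg_of_add_eq_zero_right this
    rw [hb, map_neg, map_neg, apply_apply_apply hskew, neg_smul, neg_neg, smul_neg, add_neg_cancel]

/-- Backward direction: `A (A b) + ‖ω(A)‖² b = 0` for skew `A` gives a pitchless Killing field, with the explicit
foot `c = ‖ω(A)‖⁻² A b` of the axis when `A ≠ 0`. [folklore] -/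
theorem pitchless_of_defect_eq_zero {A : (EuclideanSpace ℝ (Fin 3)) →L[ℝ] (EuclideanSpace ℝ (Fin 3))} {b : (EuclideanSpace ℝ (Fin 3))} (hskew : ∀ x, ⟪A x, x⟫_ℝ = 0)
    (h : A (A b) + ‖axial A‖ ^ 2 • b = 0) : A = 0 ∨ ∃ c : (EuclideanSpace ℝ (Fin 3)), ∀ y, A y + b = A (y - c) := by
  by_cases hA : A = 0
  · exact Or.inl hA
  · right
    have hω : ‖axial A‖ ^ 2 ≠ 0 := by
      intro h0
      exact hA (eq_zero_of_axial_eq_zero hskew (norm_eq_zero.1 (pow_eq_zero_iff two_ne_zero |>.1 h0)))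
    refine ⟨(‖axial A‖ ^ 2)⁻¹ • A b, fun y => ?_⟩
    have e : A (A b) = -(‖axial A‖ ^ 2 • b) := eq_neg_of_add_eq_zero_left h
    rw [map_sub, map_smul, e, smul_neg, smul_smul, inv_mul_cancel₀ hω, one_smul, sub_neg_eq_add]

/-- The pitchless defect is continuous in `(A, b)`: limits of pitchless Killing fields are pitchless. [folklore] -/
theorem tendsto_defect {ι : Type*} {l : Filter ι} {A : ι → (EuclideanSpace ℝ (Fin 3)) →L[ℝ] (EuclideanSpace ℝ (Fin 3))} {b : ι → (EuclideanSpace ℝ (Fin 3))} {B : (EuclideanSpace ℝ (Fin 3)) →L[ℝ] (EuclideanSpace ℝ (Fin 3))} {e : (EuclideanSpace ℝ (Fin 3))}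
    (hA : Tendsto A l (𝓝 B)) (hb : Tendsto b l (𝓝 e)) :
    Tendsto (fun j => A j (A j (b j)) + ‖axial (A j)‖ ^ 2 • b j) l (𝓝 (B (B e) + ‖axial B‖ ^ 2 • e)) := by
  have hev : Continuous fun p : ((EuclideanSpace ℝ (Fin 3)) →L[ℝ] (EuclideanSpace ℝ (Fin 3))) × (EuclideanSpace ℝ (Fin 3)) => p.1 p.2 := continuous_fst.clm_apply continuous_snd
  have h1 : Tendsto (fun j => A j (b j)) l (𝓝 (B e)) := (hev.tendsto (B, e)).comp (hA.prodMk_nhds hb)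
  have h2 : Tendsto (fun j => A j (A j (b j))) l (𝓝 (B (B e))) := (hev.tendsto (B, B e)).comp (hA.prodMk_nhds h1)
  have hax : Tendsto (fun j => axial (A j)) l (𝓝 (axial B)) := by
    have hc : ∀ (v : (EuclideanSpace ℝ (Fin 3))) (i : Fin 3), Tendsto (fun j => A j v i) l (𝓝 (B v i)) := fun v i =>
      (continuous_apply i |>.tendsto _).comp <|
        ((PiLp.continuous_ofLp 2 _).tendsto _).comp ((hev.tendsto (B, v)).comp (hA.prodMk_nhds tendsto_const_nhds))
    simp only [axial]
    exact (((hc _ 2).smul tendsto_const_nhds).add ((hc _ 2).neg.smul tendsto_const_nhds)).add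
      ((hc _ 1).smul tendsto_const_nhds)
  exact h2.add ((hax.norm.pow 2).smul hb)

end RigidZoom

namespace ZoomFading

/-- Evaluation `(G, b) ↦ G b` is jointly continuous: `G_j → G` in operator norm and `b_j → b` give
`G_j b_j → G b`. [folklore] -/
theorem tendsto_clm_apply {ι : Type*} {l : Filter ι}
    {G : ι → (EuclideanSpace ℝ (Fin 3)) →L[ℝ] (EuclideanSpace ℝ (Fin 3))} {G₀ : (EuclideanSpace ℝ (Fin 3)) →L[ℝ] (EuclideanSpace ℝ (Fin 3))} {b : ι → (EuclideanSpace ℝ (Fin 3))} {b₀ : (EuclideanSpace ℝ (Fin 3))}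
    (hG : Tendsto G l (𝓝 G₀)) (hb : Tendsto b l (𝓝 b₀)) :
    Tendsto (fun j => G j (b j)) l (𝓝 (G₀ b₀)) := by
  have hc : Continuous fun p : ((EuclideanSpace ℝ (Fin 3)) →L[ℝ] (EuclideanSpace ℝ (Fin 3))) × (EuclideanSpace ℝ (Fin 3)) => p.1 p.2 := continuous_fst.clm_apply continuous_snd
  exact (hc.tendsto (G₀, b₀)).comp (hG.prodMk_nhds hb)

/-- Mean-square fading of a vector functional on balls gives mean-square fading of its pairing with
any vector of norm `≤ 1` (`⟪F, e⟫² ≤ ‖F‖²`). [folklore] -/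
theorem fading_inner_of_fading_norm_sq {F : ℕ → (EuclideanSpace ℝ (Fin 3)) → (EuclideanSpace ℝ (Fin 3))} {R : ℝ} {e : (EuclideanSpace ℝ (Fin 3))} (he : ‖e‖ ≤ 1)
    (h : Tendsto (fun j => ∫⁻ y in ball (0 : (EuclideanSpace ℝ (Fin 3))) R, ENNReal.ofReal (‖F j y‖ ^ 2)) atTop (𝓝 0)) :
    Tendsto (fun j => ∫⁻ y in ball (0 : (EuclideanSpace ℝ (Fin 3))) R, ENNReal.ofReal ((⟪F j y, e⟫_ℝ) ^ 2)) atTop (𝓝 0) := by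
  refine tendsto_of_tendsto_of_tendsto_of_le_of_le tendsto_const_nhds h (fun _ => bot_le)
    fun j => lintegral_mono fun y => ENNReal.ofReal_le_ofReal ?_
  have h1 : |⟪F j y, e⟫_ℝ| ≤ ‖F j y‖ := by
    calc |⟪F j y, e⟫_ℝ| ≤ ‖F j y‖ * ‖e‖ := abs_real_inner_le_norm _ _
      _ ≤ ‖F j y‖ * 1 := by gcongr
      _ = ‖F j y‖ := mul_one _
  calc (⟪F j y, e⟫_ℝ) ^ 2 = |⟪F j y, e⟫_ℝ| ^ 2 := (sq_abs _).symm
    _ ≤ ‖F j y‖ ^ 2 := pow_le_pow_left₀ (abs_nonneg _) h1 2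

/-- **Mean-square fading of a VECTOR functional forces a vanishing pointwise limit**. [folklore] -/
theorem eq_zero_of_fading_norm_sq {F : ℕ → (EuclideanSpace ℝ (Fin 3)) → (EuclideanSpace ℝ (Fin 3))} {g : (EuclideanSpace ℝ (Fin 3)) → (EuclideanSpace ℝ (Fin 3))} (hg : Continuous g)
    (hF : ∀ j, Measurable (F j)) (hlim : ∀ y, Tendsto (fun j => F j y) atTop (𝓝 (g y)))
    (hfade : ∀ R : ℝ, 0 < R → Tendsto (fun j => ∫⁻ y in ball (0 : (EuclideanSpace ℝ (Fin 3))) R,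
      ENNReal.ofReal (‖F j y‖ ^ 2)) atTop (𝓝 0)) :
    ∀ y, g y = 0 := by
  have key : ∀ e : (EuclideanSpace ℝ (Fin 3)), ‖e‖ ≤ 1 → ∀ y, ⟪g y, e⟫_ℝ = 0 := by
    intro e he
    refine eq_zero_of_fading_sq (hg.inner continuous_const) (fun j => (hF j).inner measurable_const)
      (fun y => (hlim y).inner tendsto_const_nhds) fun R hR => fading_inner_of_fading_norm_sq he (hfade R hR)
  intro y
  by_contra hne
  have hn : ‖g y‖ ≠ 0 := norm_ne_zero_iff.2 hne
  have he : ‖(‖g y‖⁻¹ : ℝ) • g y‖ ≤ 1 := (norm_smul_inv_norm hne).le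
  have h := key _ he y
  rw [real_inner_smul_right, real_inner_self_eq_norm_sq, pow_two, ← mul_assoc,
    inv_mul_cancel₀ hn, one_mul] at h
  exact hn h

end ZoomFading

open LocalSineTubeDoorLocalPointZoomGradSlices ZoomFading RigidZoom
  Summit.NavierStokesRegularity.NavierStokesRegularity.Theorems.LocalSineTubeDoorProfileAlignedWindowRigidityAncient in
/-- **Item stmt-NavierStokesRegularity-27903** (`RigidMotionDoor.RigidZoom`): at a locally Type-I, not backward bounded point at which the
scale-invariant defect of `u` along a (time-dependent) normalised PITCHLESS Killing field `y ↦ A t y + b t` fades in mean square on every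
window, the local point zoom limit is a Type-I ancient Oseen-mild profile, backward singular at the apex, each of whose slices is annihilated
by some non-zero pitchless Killing field: `∇v(s)(y)(B y + e) − B (v s y) = 0`.  Proof: universal first-order zoom `localPointZoomVelGradSlices`;
at each `s < 0` the pairs `(A, b)(t_j)` along the zoom times lie in the unit ball of `(E →L E) × E`, so a subsequence converges to `(B, e)`
with `‖B‖ + ‖e‖ = 1`, `B` skew, and PITCHLESS by the closed form of pitchlessness (`RigidZoom.defect_eq_zero_of_pitchless`,
`tendsto_defect`, `pitchless_of_defect_eq_zero`); along the subsequence the defect functional tends to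
`(cν) • [∇v(s)(z)(B z + c•e) − B v(s,z)]` (`z = c y′`, `c = √(−s/ν)`), the door hypothesis makes it fade in mean square, and the vector fading
lemma kills it; the slice symmetry is the pitchless pair `(B, c • e) ≠ (0,0)`.
[cite: SereginSverak2009, §3; KochNadirashviliSereginSverak2009, §5–6; AlbrittonBarker2019, §2] -/
theorem rigidMotionDoor_rigidZoom_proof :
    Summit.NavierStokesRegularity.NavierStokesRegularity.Theses.RigidMotionDoor.RigidZoom := by
  intro ν T hν hT u p hsol hLH hdec x₀ ρ M hρ hM A b hAb hfade hnotbd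
  obtain ⟨C, v, lam, hlam, hlam0, hclass, hsing, hzoom⟩ :=
    localPointZoomVelGradSlices ν T hν hT u p hsol hLH hdec x₀ ρ M hρ hM hnotbd
  refine ⟨C, v, hclass, hsing, fun s hs => ?_⟩
  obtain ⟨hrate, hcont, hmild, hdiv⟩ := hclass
  -- the class is the tree's `IsTypeIAncientMild`, so the slice `v s` is `C¹` with continuous gradient
  have hAM : IsTypeIAncientMild C v := by
    refine ⟨(analyticOnNhd_uncurry hcont (bdd_of_hasTypeITimeDecay hrate) hmild).contDiffOn_of_completeSpace,
      fun t ht => hdiv t ht, fun s t hst ht x => ?_, hrate⟩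
    rw [heatFlow_of_pos _ (sub_pos.2 hst)]
    exact hmild s t hst ht x
  have hv1 : ContDiff ℝ 1 (v s) := (hAM.contDiff_slice hs).of_le (by exact_mod_cast le_top)
  have hvs : Continuous (v s) := hv1.continuous
  have hDv : Continuous (fderiv ℝ (v s)) := hv1.continuous_fderiv one_ne_zero
  -- the similarity factor `c = √(−s/ν)` and the zoom times `t_j = T + λ_j² s/ν → T⁻`
  have hν0 : ν ≠ 0 := hν.ne'
  have hsν : 0 < -s / ν := div_pos (neg_pos.2 hs) hν
  set c : ℝ := Real.sqrt (-s / ν) with hcdef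
  have hc : 0 < c := Real.sqrt_pos.2 hsν
  have hc2 : c ^ 2 = -s / ν := Real.sq_sqrt hsν.le
  set tj : ℕ → ℝ := fun j => T + lam j ^ 2 * s / ν with htjdef
  have htjT : ∀ j, tj j < T := fun j => by
    have : lam j ^ 2 * s / ν < 0 :=
      div_neg_of_neg_of_pos (mul_neg_of_pos_of_neg (pow_pos (hlam j) 2) hs) hν
    simp only [htjdef]; linarith
  have htj_sub : ∀ j, T - tj j = lam j ^ 2 * c ^ 2 := fun j => by
    rw [hc2]; simp only [htjdef]; ring
  have hsqrt : ∀ j, Real.sqrt (T - tj j) = lam j * c := fun j => by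
    rw [htj_sub, Real.sqrt_mul (sq_nonneg _), Real.sqrt_sq (hlam j).le, Real.sqrt_sq hc.le]
  have htj_nhds : Tendsto tj atTop (𝓝 T) := by
    have h1 : Tendsto (fun j => T + lam j ^ 2 * s / ν) atTop (𝓝 (T + 0 ^ 2 * s / ν)) :=
      (((hlam0.pow 2).mul_const s).div_const ν).const_add T
    simpa using h1
  obtain ⟨N, hN⟩ : ∃ N : ℕ, ∀ j ≥ N, 0 ≤ tj j := by
    obtain ⟨N, hN⟩ := eventually_atTop.1 (htj_nhds.eventually (lt_mem_nhds hT))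
    exact ⟨N, fun j hj => (hN j hj).le⟩
  -- compactness of the unit ball of `(E →L E) × E`: along a subsequence `(A, b)(t_j) → (B, e)`
  obtain ⟨P, -, φ, hφ, hP⟩ :=
    (isCompact_closedBall ((0 : ((EuclideanSpace ℝ (Fin 3)) →L[ℝ] (EuclideanSpace ℝ (Fin 3))) × (EuclideanSpace ℝ (Fin 3)))) 1).tendsto_subseq
      (x := fun j => (A (tj (j + N)), b (tj (j + N)))) fun j => by
        have h := (hAb (tj (j + N))).2.2
        rw [mem_closedBall, dist_zero_right, Prod.norm_def, max_le_iff]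
        constructor
        · show ‖A (tj (j + N))‖ ≤ 1
          linarith [norm_nonneg (b (tj (j + N)))]
        · show ‖b (tj (j + N))‖ ≤ 1
          linarith [norm_nonneg (A (tj (j + N)))]
  set B : (EuclideanSpace ℝ (Fin 3)) →L[ℝ] (EuclideanSpace ℝ (Fin 3)) := P.1 with hBdef
  set e : (EuclideanSpace ℝ (Fin 3)) := P.2 with hedef
  set idx : ℕ → ℕ := fun j => φ j + N with hidxdef
  have hidx : Tendsto idx atTop atTop := (tendsto_add_atTop_nat N).comp hφ.tendsto_atTop
  have hAB : Tendsto (fun j => A (tj (idx j))) atTop (𝓝 B) := (continuous_fst.tendsto P).comp hP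
  have hbe : Tendsto (fun j => b (tj (idx j))) atTop (𝓝 e) := (continuous_snd.tendsto P).comp hP
  have hBskew : ∀ x, ⟪B x, x⟫_ℝ = 0 := fun x => by
    have h1 : Tendsto (fun j => ⟪A (tj (idx j)) x, x⟫_ℝ) atTop (𝓝 ⟪B x, x⟫_ℝ) :=
      (tendsto_clm_apply hAB tendsto_const_nhds).inner tendsto_const_nhds
    have h2 : Tendsto (fun j => ⟪A (tj (idx j)) x, x⟫_ℝ) atTop (𝓝 0) := by
      simp only [(hAb _).1]; exact tendsto_const_nhds
    exact tendsto_nhds_unique h1 h2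
  have hsum : ‖B‖ + ‖e‖ = 1 := by
    have h1 : Tendsto (fun j => ‖A (tj (idx j))‖ + ‖b (tj (idx j))‖) atTop (𝓝 (‖B‖ + ‖e‖)) := hAB.norm.add hbe.norm
    have h2 : Tendsto (fun j => ‖A (tj (idx j))‖ + ‖b (tj (idx j))‖) atTop (𝓝 1) := by
      simp only [(hAb _).2.2]; exact tendsto_const_nhds
    exact tendsto_nhds_unique h1 h2
  -- the pitchless condition passes to the limit through its closed form
  have hdef : B (B e) + ‖axial B‖ ^ 2 • e = 0 := by
    have h1 := tendsto_defect hAB hbe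
    have h2 : Tendsto (fun j => A (tj (idx j)) (A (tj (idx j)) (b (tj (idx j)))) +
        ‖axial (A (tj (idx j)))‖ ^ 2 • b (tj (idx j))) atTop (𝓝 0) := by
      have : ∀ j, A (tj (idx j)) (A (tj (idx j)) (b (tj (idx j)))) + ‖axial (A (tj (idx j)))‖ ^ 2 • b (tj (idx j)) = 0 :=
        fun j => defect_eq_zero_of_pitchless (hAb _).1 (hAb _).2.1
      simp only [this]; exact tendsto_const_nhds
    exact tendsto_nhds_unique h1 h2
  -- the limit Killing field, rescaled to the slice: `(B, c • e)`
  refine ⟨B, c • e, hBskew, ?_, ?_, ?_⟩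
  · refine pitchless_of_defect_eq_zero hBskew ?_
    rw [map_smul, map_smul, smul_comm (‖axial B‖ ^ 2) c e, ← smul_add, hdef, smul_zero]
  · rintro ⟨hB0, he0⟩
    have he : e = 0 := by
      rcases smul_eq_zero.1 he0 with h | h
      · exact absurd h hc.ne'
      · exact h
    rw [hB0, he, norm_zero, norm_zero, add_zero] at hsum
    exact zero_ne_one hsum
  -- the physical times along the subsequence
  have htjI : ∀ j, tj (idx j) ∈ Ico 0 T := fun j =>
    ⟨hN _ (Nat.le_add_left N (φ j)), htjT _⟩
  have htj_tend : Tendsto (fun j => tj (idx j)) atTop (𝓝[<] T) :=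
    tendsto_nhdsWithin_iff.2 ⟨htj_nhds.comp hidx, Eventually.of_forall fun j => htjT _⟩
  -- the door functionals along the subsequence and their pointwise limit
  set F : ℕ → (EuclideanSpace ℝ (Fin 3)) → (EuclideanSpace ℝ (Fin 3)) := fun j y' =>
    (T - tj (idx j)) • fderiv ℝ (u (tj (idx j))) (x₀ + Real.sqrt (T - tj (idx j)) • y') (A (tj (idx j)) y' + b (tj (idx j))) -
      Real.sqrt (T - tj (idx j)) • A (tj (idx j)) (u (tj (idx j)) (x₀ + Real.sqrt (T - tj (idx j)) • y'))
    with hFdef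
  set g : (EuclideanSpace ℝ (Fin 3)) → (EuclideanSpace ℝ (Fin 3)) := fun y' =>
    (c * ν) • (fderiv ℝ (v s) (c • y') (B (c • y') + c • e) - B (v s (c • y'))) with hgdef
  have hg : Continuous g := by
    have h1 : Continuous fun y' : (EuclideanSpace ℝ (Fin 3)) => c • y' := continuous_const_smul c
    have h2 : Continuous fun y' : (EuclideanSpace ℝ (Fin 3)) => fderiv ℝ (v s) (c • y') (B (c • y') + c • e) :=
      (hDv.comp h1).clm_apply ((B.continuous.comp h1).add continuous_const)
    have h3 : Continuous fun y' : (EuclideanSpace ℝ (Fin 3)) => B (v s (c • y')) := B.continuous.comp (hvs.comp h1)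
    exact (h2.sub h3).const_smul (c * ν)
  have hF : ∀ j, Measurable (F j) := by
    intro j
    have huC : ContDiff ℝ 1 (u (tj (idx j))) :=
      (hsol.contDiff_velocity (htjI j)).of_le (by exact_mod_cast le_top)
    have huc : Continuous (u (tj (idx j))) := huC.continuous
    have hDu : Continuous (fderiv ℝ (u (tj (idx j)))) := huC.continuous_fderiv one_ne_zero
    have h1 : Continuous fun y' : (EuclideanSpace ℝ (Fin 3)) => x₀ + Real.sqrt (T - tj (idx j)) • y' :=
      continuous_const.add (continuous_const_smul _)
    have h2 : Continuous fun y' : (EuclideanSpace ℝ (Fin 3)) =>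
        fderiv ℝ (u (tj (idx j))) (x₀ + Real.sqrt (T - tj (idx j)) • y') (A (tj (idx j)) y' + b (tj (idx j))) :=
      (hDu.comp h1).clm_apply ((A _).continuous.add continuous_const)
    have h3 : Continuous fun y' : (EuclideanSpace ℝ (Fin 3)) => A (tj (idx j)) (u (tj (idx j)) (x₀ + Real.sqrt (T - tj (idx j)) • y')) :=
      (A _).continuous.comp (huc.comp h1)
    exact ((h2.const_smul (T - tj (idx j))).sub (h3.const_smul (Real.sqrt (T - tj (idx j))))).measurable
  have hlimF : ∀ y', Tendsto (fun j => F j y') atTop (𝓝 (g y')) := by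
    intro y'
    have hV : Tendsto (fun j => (lam (idx j) / ν) • u (tj (idx j)) (x₀ + lam (idx j) • c • y')) atTop
        (𝓝 (v s (c • y'))) := (hzoom s hs (c • y')).1.comp hidx
    have hG : Tendsto (fun j => (lam (idx j) ^ 2 / ν) •
        fderiv ℝ (u (tj (idx j))) (x₀ + lam (idx j) • c • y')) atTop (𝓝 (fderiv ℝ (v s) (c • y'))) :=
      (hzoom s hs (c • y')).2.comp hidx
    have hAz : Tendsto (fun j => A (tj (idx j)) (c • y') + c • b (tj (idx j))) atTop (𝓝 (B (c • y') + c • e)) :=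
      (tendsto_clm_apply hAB tendsto_const_nhds).add (hbe.const_smul c)
    have h1 := tendsto_clm_apply hG hAz
    have h2 := tendsto_clm_apply hAB hV
    have h3 := (h1.sub h2).const_smul (c * ν)
    refine h3.congr fun j => ?_
    -- the algebra: `(cν) • (G_j (A_j (c • y') + c • b_j) − A_j V_j) = F j y'`
    simp only [hFdef]
    have hlin : A (tj (idx j)) (c • y') + c • b (tj (idx j)) = c • (A (tj (idx j)) y' + b (tj (idx j))) := by
      rw [smul_add, map_smul]
    rw [hlin, hsqrt (idx j), htj_sub (idx j), ← smul_smul (lam (idx j)) c y']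
    simp only [smul_apply, map_smul, smul_sub, smul_smul]
    congr 1
    · congr 1
      field_simp
    · congr 1
      field_simp
  have hfadeF : ∀ R : ℝ, 0 < R → Tendsto (fun j => ∫⁻ y' in ball (0 : (EuclideanSpace ℝ (Fin 3))) R,
      ENNReal.ofReal (‖F j y'‖ ^ 2)) atTop (𝓝 0) := fun R hR => (hfade R hR).comp htj_tend
  -- the fading lemma: `g = 0`; read it at `y' = c⁻¹ • y`
  intro y
  have hgy := eq_zero_of_fading_norm_sq hg hF hlimF hfadeF (c⁻¹ • y)
  have hcy : c • c⁻¹ • y = y := by rw [smul_smul, mul_inv_cancel₀ hc.ne', one_smul]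
  simp only [hgdef, hcy] at hgy
  exact (smul_eq_zero.1 hgy).resolve_left (mul_ne_zero hc.ne' hν0)


end Summit.NavierStokesRegularity.NavierStokesRegularity.Theorems

end
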